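import Summits.ValiantsHypothesis.ValiantsHypothesis.Theorems.AnyonJetsUniformJetUpperBoundWitness
import Literature.Computability.AlgebraicComplexity.ConstantFreeDegree
import HarnessLib

/-!
# AnyonJets — the inversion pencil with a variable coupling is a `VNP⁰` family (constant-free)

`P_n(q; X) = ∑_σ q^{inv σ} ∏ᵢ X_{σ i, i} ∈ ℤ[q, X_{ij}]` (variables `Option (Fin n × Fin n)`,
`q = X none`), the inversion (Mahonian) pencil of route `ValiantsHypothesis/AnyonJets`, is in
Bürgisser's constant-free class `VNP⁰` (Bürgisser 2009, Def. 2.8): `isVNP0Family_pencil`.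

The tree already has the `VNP` witness over every commutative ring `K`
(`AnyonJetsUniformJetUpperBoundWitness.lean`, `UniformJet.boolSum_witness`: BCS's permutation-matrix
recogniser `α(Z) β(Z)` on a position matrix `Z ∈ {0,1}^{n×n}`, the inversion gadgets
`1 + (q - 1)·∑_{j<i} Z_{(a,i)} Z_{(b,j)}` and the cover product, Boolean sum `= P_n`). That witness
uses only the constants `±1`, so the `(size, formal degree)` calculus `HasTauDeg`
(`ConstantFreeDegree.lean`) puts the witness family in `VP⁰` (size `≤ 13(n+1)⁴`, formal degree
`≤ 6(n+1)⁴`, `2n² + 1` variables; `hasTauDeg_pencilWitness`, `isVP0Family_pencilWitness`), whence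
`(P_n)_n ∈ VNP⁰` at `K = ℤ` — exactly as `PermanentVNP0.lean` / `HamiltonianCycleVNP0.lean` do for
`PER` / `HC`.

Use (crux `JetConstantElim`, stmt-ValiantsHypothesis-16737, stub `stub_multiplierRemoval`): with
Bürgisser 2009 Thm. 2.10 (`Burgisser2009_thm210_holds`), `τ(PER) = n^{O(1)}` makes
`2^{p(n)} P_n` constant-free cheap, hence (integral interpolation) some multiple of every jet
`J_(n,k)` uniformly cheap — the conditional source of the "cheap multiples" that, with the sibling
crux `ConstantFreeJetGrowth`, refute the stub (`AnyonJetsJetConstantElimMultiplierRemovalPerEasy.lean`).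
Theorem-only file; no named facts. HONEST FRAMING: a class membership; VP ≠ VNP is NOT proved.

References: P. Bürgisser, *On defining integers and proving arithmetic circuit lower bounds*,
Comput. Complexity 18 (2009), Def. 2.7–2.8; P. Bürgisser, M. Clausen, M. A. Shokrollahi,
*Algebraic Complexity Theory*, Springer 1997, Prop. (21.15) (the recogniser); L. G. Valiant,
*Completeness classes in algebra*, STOC 1979, §4.
-/

noncomputable section

-- single-conjunct layout: Sub = Summit, duplicated namespace component intended
set_option linter.dupNamespace false

namespace Summit.ValiantsHypothesis.ValiantsHypothesis.Theorems.AnyonJets.UniformJet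

open Literature.Computability.AlgebraicComplexity MvPolynomial Equiv Finset

/-! ### Size and formal degree of the four factors of the witness (over `ℤ`) -/

section TauDeg

variable (n : ℕ)

/-- BCS's `α(Z) = ∏_{conflicting (p,q)} (1 - Z_p Z_q)`: size `≤ 4n⁴`, formal degree `≤ 2n⁴ + 1`.
[cite: BurgisserClausenShokrollahi1997, Prop. (21.15)] -/
theorem hasTauDeg_alpha :
    HasTauDeg (∏ pq ∈ conflictPairs n, (1 - X (Sum.inr (finProdFinEquiv pq.1)) *
        X (Sum.inr (finProdFinEquiv pq.2))) :
      MvPolynomial (Option (Fin n × Fin n) ⊕ Fin (n * n)) ℤ) (4 * n ^ 4) (2 * n ^ 4 + 1) := by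
  have hterm : ∀ pq ∈ conflictPairs n,
      HasTauDeg ((1 - X (Sum.inr (finProdFinEquiv pq.1)) * X (Sum.inr (finProdFinEquiv pq.2)) :
        MvPolynomial (Option (Fin n × Fin n) ⊕ Fin (n * n)) ℤ)) 3 2 := by
    intro pq _
    have h := ((HasTauDeg.X (σ := Option (Fin n × Fin n) ⊕ Fin (n * n))
      (Sum.inr (finProdFinEquiv pq.1))).mul (HasTauDeg.X (Sum.inr (finProdFinEquiv pq.2)))).one_sub
    exact h.mono (by omega) (by simp)
  have hcard := card_conflictPairs_le n
  refine (HasTauDeg.finset_prod _ hterm).mono ?_ ?_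
  · simp only [Finset.sum_const, smul_eq_mul]
    nlinarith
  · nlinarith

/-- BCS's `β(Z) = ∏_t ∑_i Z_{(t,i)}`: size `≤ n² + n`, formal degree `≤ n + 1`.
[cite: BurgisserClausenShokrollahi1997, Prop. (21.15)] -/
theorem hasTauDeg_beta :
    HasTauDeg (∏ t : Fin n, ∑ i : Fin n, X (Sum.inr (finProdFinEquiv (t, i))) :
      MvPolynomial (Option (Fin n × Fin n) ⊕ Fin (n * n)) ℤ) (n * n + n) (n + 1) := by
  have hrow : ∀ t ∈ (Finset.univ : Finset (Fin n)),
      HasTauDeg (∑ i : Fin n, (X (Sum.inr (finProdFinEquiv (t, i))) :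
        MvPolynomial (Option (Fin n × Fin n) ⊕ Fin (n * n)) ℤ)) n 1 := by
    intro t _
    refine (HasTauDeg.finset_sum _ fun i _ =>
      HasTauDeg.X (σ := Option (Fin n × Fin n) ⊕ Fin (n * n)) (Sum.inr (finProdFinEquiv (t, i)))).mono ?_ ?_
    · simp
    · simp
  refine (HasTauDeg.finset_prod _ hrow).mono ?_ ?_
  · simp
  · simp

/-- One inversion gadget `1 + (q - 1) · ∑_{j<i} Z_{(a,i)} Z_{(b,j)}`: size `≤ 2n² + 4`, formal
degree `≤ 3`. [folklore] -/
theorem hasTauDeg_gadget (ab : Fin n × Fin n) :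
    HasTauDeg ((1 + ((X (Sum.inl none) : MvPolynomial (Option (Fin n × Fin n) ⊕ Fin (n * n)) ℤ) - 1) *
        ∑ ij ∈ Finset.univ.filter (fun ij : Fin n × Fin n => ij.2 < ij.1),
          X (Sum.inr (finProdFinEquiv (ab.1, ij.1))) * X (Sum.inr (finProdFinEquiv (ab.2, ij.2)))) :
      MvPolynomial (Option (Fin n × Fin n) ⊕ Fin (n * n)) ℤ) (2 * (n * n) + 4) 3 := by
  have hcard : (Finset.univ.filter (fun ij : Fin n × Fin n => ij.2 < ij.1)).card ≤ n * n :=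
    (Finset.card_filter_le _ _).trans (by simp)
  have hterm : ∀ ij ∈ Finset.univ.filter (fun ij : Fin n × Fin n => ij.2 < ij.1),
      HasTauDeg ((X (Sum.inr (finProdFinEquiv (ab.1, ij.1))) *
          X (Sum.inr (finProdFinEquiv (ab.2, ij.2))) :
        MvPolynomial (Option (Fin n × Fin n) ⊕ Fin (n * n)) ℤ)) 1 2 := by
    intro ij _
    have h := (HasTauDeg.X (σ := Option (Fin n × Fin n) ⊕ Fin (n * n))
      (Sum.inr (finProdFinEquiv (ab.1, ij.1)))).mul
      (HasTauDeg.X (Sum.inr (finProdFinEquiv (ab.2, ij.2))))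
    exact h.mono (by omega) (by omega)
  have hS : HasTauDeg (∑ ij ∈ Finset.univ.filter (fun ij : Fin n × Fin n => ij.2 < ij.1),
      (X (Sum.inr (finProdFinEquiv (ab.1, ij.1))) * X (Sum.inr (finProdFinEquiv (ab.2, ij.2))) :
        MvPolynomial (Option (Fin n × Fin n) ⊕ Fin (n * n)) ℤ)) (2 * (n * n)) 2 := by
    refine (HasTauDeg.finset_sum _ hterm).mono ?_ ?_
    · simp only [Finset.sum_const, smul_eq_mul]
      omega
    · simp
  have hU : HasTauDeg ((X (Sum.inl none) : MvPolynomial (Option (Fin n × Fin n) ⊕ Fin (n * n)) ℤ) - 1)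
      2 1 := by
    have h := (HasTauDeg.X (σ := Option (Fin n × Fin n) ⊕ Fin (n * n)) (Sum.inl none)).sub
      HasTauDeg.one
    exact h.mono (by omega) (by simp)
  have h := HasTauDeg.one.add (hU.mul hS)
  exact h.mono (by omega) (by simp)

/-- The product of the inversion gadgets over the pairs `a < b`: size `≤ n²(2n² + 4) + n²`,
formal degree `≤ 3n² + 1`. [folklore] -/
theorem hasTauDeg_gadgets :
    HasTauDeg (∏ ab ∈ Finset.univ.filter (fun ab : Fin n × Fin n => ab.1 < ab.2),
        (1 + ((X (Sum.inl none) : MvPolynomial (Option (Fin n × Fin n) ⊕ Fin (n * n)) ℤ) - 1) *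
          ∑ ij ∈ Finset.univ.filter (fun ij : Fin n × Fin n => ij.2 < ij.1),
            X (Sum.inr (finProdFinEquiv (ab.1, ij.1))) * X (Sum.inr (finProdFinEquiv (ab.2, ij.2)))) :
      MvPolynomial (Option (Fin n × Fin n) ⊕ Fin (n * n)) ℤ)
      (n * n * (2 * (n * n) + 4) + n * n) (n * n * 3 + 1) := by
  have hcard : (Finset.univ.filter (fun ab : Fin n × Fin n => ab.1 < ab.2)).card ≤ n * n :=
    (Finset.card_filter_le _ _).trans (by simp)
  refine (HasTauDeg.finset_prod _ fun ab _ => hasTauDeg_gadget n ab).mono ?_ ?_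
  · simp only [Finset.sum_const, smul_eq_mul]
    nlinarith
  · nlinarith

/-- The cover product `∏_t ∑_i Z_{(t,i)} X_{(i,t)}`: size `≤ 2n² + n`, formal degree `≤ 2n + 1`.
[cite: BurgisserClausenShokrollahi1997, Prop. (21.15)] -/
theorem hasTauDeg_cover :
    HasTauDeg (∏ t : Fin n, ∑ i : Fin n, X (Sum.inr (finProdFinEquiv (t, i))) *
        X (Sum.inl (some (i, t))) :
      MvPolynomial (Option (Fin n × Fin n) ⊕ Fin (n * n)) ℤ) (n * (2 * n) + n) (n * 2 + 1) := by
  have hterm : ∀ (t i : Fin n),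
      HasTauDeg ((X (Sum.inr (finProdFinEquiv (t, i))) * X (Sum.inl (some (i, t))) :
        MvPolynomial (Option (Fin n × Fin n) ⊕ Fin (n * n)) ℤ)) 1 2 := by
    intro t i
    have h := (HasTauDeg.X (σ := Option (Fin n × Fin n) ⊕ Fin (n * n))
      (Sum.inr (finProdFinEquiv (t, i)))).mul (HasTauDeg.X (Sum.inl (some (i, t))))
    exact h.mono (by omega) (by omega)
  have hrow : ∀ t ∈ (Finset.univ : Finset (Fin n)),
      HasTauDeg (∑ i : Fin n, (X (Sum.inr (finProdFinEquiv (t, i))) * X (Sum.inl (some (i, t))) :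
        MvPolynomial (Option (Fin n × Fin n) ⊕ Fin (n * n)) ℤ)) (2 * n) 2 := by
    intro t _
    refine (HasTauDeg.finset_sum _ fun i _ => hterm t i).mono ?_ ?_
    · simp; omega
    · simp
  refine (HasTauDeg.finset_prod _ hrow).mono ?_ ?_
  · simp
  · simp

/-- **The witness is constant-free cheap**: size `≤ 13(n+1)⁴`, formal degree `≤ 6(n+1)⁴`.
[cite: BurgisserClausenShokrollahi1997, Prop. (21.15)] -/
theorem hasTauDeg_pencilWitness :
    HasTauDeg ((∏ pq ∈ conflictPairs n, (1 - X (Sum.inr (finProdFinEquiv pq.1)) *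
          X (Sum.inr (finProdFinEquiv pq.2)))) *
        (∏ t : Fin n, ∑ i : Fin n, X (Sum.inr (finProdFinEquiv (t, i)))) *
        ((∏ ab ∈ Finset.univ.filter (fun ab : Fin n × Fin n => ab.1 < ab.2),
          (1 + ((X (Sum.inl none) : MvPolynomial (Option (Fin n × Fin n) ⊕ Fin (n * n)) ℤ) - 1) *
            ∑ ij ∈ Finset.univ.filter (fun ij : Fin n × Fin n => ij.2 < ij.1),
              X (Sum.inr (finProdFinEquiv (ab.1, ij.1))) *
                X (Sum.inr (finProdFinEquiv (ab.2, ij.2))))) *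
          ∏ t : Fin n, ∑ i : Fin n, X (Sum.inr (finProdFinEquiv (t, i))) *
            X (Sum.inl (some (i, t)))) :
      MvPolynomial (Option (Fin n × Fin n) ⊕ Fin (n * n)) ℤ) (13 * (n + 1) ^ 4) (6 * (n + 1) ^ 4) := by
  have h := ((hasTauDeg_alpha n).mul (hasTauDeg_beta n)).mul
    ((hasTauDeg_gadgets n).mul (hasTauDeg_cover n))
  refine h.mono ?_ ?_
  · have e1 : n ^ 4 ≤ (n + 1) ^ 4 := Nat.pow_le_pow_left (Nat.le_succ n) 4
    have e2 : n ≤ (n + 1) ^ 4 := by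
      calc n ≤ n + 1 := Nat.le_succ n
        _ = (n + 1) ^ 1 := (pow_one _).symm
        _ ≤ (n + 1) ^ 4 := Nat.pow_le_pow_right (Nat.succ_pos n) (by norm_num)
    have e3 : n * n ≤ (n + 1) ^ 4 := by
      calc n * n ≤ (n + 1) * (n + 1) := Nat.mul_le_mul (Nat.le_succ n) (Nat.le_succ n)
        _ = (n + 1) ^ 2 := (sq _).symm
        _ ≤ (n + 1) ^ 4 := Nat.pow_le_pow_right (Nat.succ_pos n) (by norm_num)
    have e4 : n * n * (n * n) = n ^ 4 := by ring
    have e5 : 1 ≤ (n + 1) ^ 4 := Nat.one_le_pow _ _ (Nat.succ_pos n)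
    nlinarith
  · have e1 : n ^ 4 ≤ (n + 1) ^ 4 := Nat.pow_le_pow_left (Nat.le_succ n) 4
    have e2 : n ≤ (n + 1) ^ 4 := by
      calc n ≤ n + 1 := Nat.le_succ n
        _ = (n + 1) ^ 1 := (pow_one _).symm
        _ ≤ (n + 1) ^ 4 := Nat.pow_le_pow_right (Nat.succ_pos n) (by norm_num)
    have e3 : n * n ≤ (n + 1) ^ 4 := by
      calc n * n ≤ (n + 1) * (n + 1) := Nat.mul_le_mul (Nat.le_succ n) (Nat.le_succ n)
        _ = (n + 1) ^ 2 := (sq _).symm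
        _ ≤ (n + 1) ^ 4 := Nat.pow_le_pow_right (Nat.succ_pos n) (by norm_num)
    have e5 : 1 ≤ (n + 1) ^ 4 := Nat.one_le_pow _ _ (Nat.succ_pos n)
    nlinarith

end TauDeg

/-! ### `VP⁰` and `VNP⁰` membership -/

/-- **The witness family is in `VP⁰`** (`2n² + 1` variables, constant-free circuits of size
`≤ 13(n+1)⁴` and formal degree `≤ 6(n+1)⁴`; Bürgisser 2009, Def. 2.7). [cite: Burgisser2006, Def. 2.7] -/
theorem isVP0Family_pencilWitness :
    IsVP0Family (σ := fun n => Option (Fin n × Fin n) ⊕ Fin (n * n)) fun n =>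
      ((∏ pq ∈ conflictPairs n, (1 - X (Sum.inr (finProdFinEquiv pq.1)) *
          X (Sum.inr (finProdFinEquiv pq.2)))) *
        (∏ t : Fin n, ∑ i : Fin n, X (Sum.inr (finProdFinEquiv (t, i)))) *
        ((∏ ab ∈ Finset.univ.filter (fun ab : Fin n × Fin n => ab.1 < ab.2),
          (1 + ((X (Sum.inl none) : MvPolynomial (Option (Fin n × Fin n) ⊕ Fin (n * n)) ℤ) - 1) *
            ∑ ij ∈ Finset.univ.filter (fun ij : Fin n × Fin n => ij.2 < ij.1),
              X (Sum.inr (finProdFinEquiv (ab.1, ij.1))) *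
                X (Sum.inr (finProdFinEquiv (ab.2, ij.2))))) *
          ∏ t : Fin n, ∑ i : Fin n, X (Sum.inr (finProdFinEquiv (t, i))) *
            X (Sum.inl (some (i, t)))) :
      MvPolynomial (Option (Fin n × Fin n) ⊕ Fin (n * n)) ℤ) := by
  have h := fun n => hasTauDeg_pencilWitness n
  choose P h1 h2 h3 h4 h5 using h
  refine ⟨?_, P, fun n => ⟨h1 n, h2 n, h3 n⟩, ?_, ?_⟩
  · refine (IsPBounded.iff_exists_le_mul_succ_pow _).2 ⟨2, 2, fun n => ?_⟩
    simp only [Fintype.card_sum, Fintype.card_option, Fintype.card_prod, Fintype.card_fin]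
    nlinarith
  · exact (IsPBounded.iff_exists_le_mul_succ_pow _).2 ⟨13, 4, fun n => h4 n⟩
  · exact (IsPBounded.iff_exists_le_mul_succ_pow _).2 ⟨6, 4, fun n => h5 n⟩

/-- **The inversion pencil is in `VNP⁰`**: the family
`P_n(q; X) = ∑_σ q^{inv σ} ∏ᵢ X_{σ i, i} ∈ ℤ[q, X]` (variables `Option (Fin n × Fin n)`, `q = X none`,
`inv σ = #{(i,j) : i < j, σ j < σ i}`) is in Bürgisser's constant-free class `VNP⁰`, with the
position-matrix witness (`UniformJet.boolSum_witness` at `K = ℤ`) and a Boolean sum of length `n²`.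
[cite: Burgisser2006, Def. 2.8] [cite: BurgisserClausenShokrollahi1997, Prop. (21.15)] -/
theorem isVNP0Family_pencil :
    IsVNP0Family (σ := fun n => Option (Fin n × Fin n)) fun n =>
      ∑ σ : Perm (Fin n), (X none : MvPolynomial (Option (Fin n × Fin n)) ℤ) ^
          (Finset.univ.filter (fun p : Fin n × Fin n => p.1 < p.2 ∧ σ p.2 < σ p.1)).card *
        ∏ i : Fin n, X (some (σ i, i)) :=
  ⟨fun n => n * n, _, isVP0Family_pencilWitness, fun n => (boolSum_witness ℤ n).symm⟩

end Summit.ValiantsHypothesis.ValiantsHypothesis.Theorems.AnyonJets.UniformJet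

end
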